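import Literature.Probability.Percolation.SepArmsGlue
import Literature.Probability.Percolation.FiveArmInnerExtensionOff
import Literature.Probability.Percolation.HexBoundaryGeometry
import HarnessLib

/-!
# Off-centre outward extension of five well-separated arms to the sides of a fixed hexagon

Topic `Literature/Probability/Percolation`; family `crit-perc` (critical site percolation on `𝕋`,
hexagonal annuli, the well-separated events `sepArms κ n N` of `SepArmsGlue.lean`). A brick of the
proof of the named fact `Literature.Probability.Percolation.Nolin2008_thm24_fiveArm_upper`
(`FiveArmExponentFacts.lean`; P. Nolin, *Near-critical percolation in two dimensions*, EJP 13
(2008), §5.2 Thm. 24, five-arm item [arXiv 0711.4948: Thm. 23 (iii)]): the DETERMINISTIC half of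
Nolin's "`P_{1/2}(v ⇝^{5,σ} ∂S_N) ≍ P_{1/2}(0 ⇝^{5,σ} ∂S_N)` uniformly in `v ∈ S_{N/2}`" /
Kesten–Sidoravicius–Zhang's (3.12) ("`P{F(w, n)}` is of the same order for all `w ∈ S(n(1-δ))` …
based on Kesten (1987)"): five fenced arms of colours `B, W, B, B, W` landing on the middle halves
of the sides `0, …, 4` of `∂Λ_{64q}` (the event `sepArms (T,F,T,T,F) m (64q)`, centred at the
origin), together with RSW crossings of fixed boxes in the five cones, reach the sides `0, …, 4` of
an OFF-CENTRE hexagon `Λ_R + c` (`|c|_𝕋 ≤ 128q`, `R` large) — in the format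
`fiveArmLandedFrom` of `FiveArmInnerExtensionOff.lean` (arms confined to `{m ≤ |·|_𝕋} ∩ (Λ_R + c)`,
inner landing sites `ρ^{s_i}(m, t_i)` on the sides of `∂Λ_m`). The construction in the frame of side
`0` continues the staircase of `ArmSeparationFourArm.lean` (`sepOpenArmIn_glue_core`: the fenced arm
is carried to the column `x₀ = 512Q - 1`, `Q = q + 1`, along the rows `[-192q, -128q]`) by a tube
`[448Q, 512Q-1] × [-192q, -128q]` crossed vertically and a long box `[448Q, X] × [-192q, -128q]`
crossed horizontally up to the column `x₀ = X = R + c'₀` of side `0` of the shifted hexagon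
(`c' = ρ^{-s} c`); consecutive pieces cross transversally (`PathIn.relay`). The inner end of the
fenced arm lies in its inner free space (graph norm `≤ m - 1`, inside the cone), so the arm, trimmed
at its last visit to `Λ_{m-1}`, starts at a site `(m, t)`, `-m < t ≤ 0`, of side `0` of `∂Λ_m`.

* `extStrip q X`, `extEvent q X` — the two new boxes and the extension event (with the 39 pieces
  `fourGlueExt q`) in the frame of side `0`; `extZone q m s X Xc` — the zone of the extended arm of
  side `s` in the original frame;
* `sepOpenArmIn_ext_core` — the open path from the inner free space to the far column (frame `0`);
* `exists_landingSite_of_adj` — the trimming: a cone site of norm `≤ m - 1` is adjacent only to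
  sites `(m, t)`, `-m < t ≤ 0`, among those of norm `≥ m`;
* `sepOpenArmIn_ext_landed` — frame `0`: a landed open arm from `(m, t)` to the far column, off
  `Λ̊_m`; `sepArms_ext_subset_landedFrom` — **the five arms**:
  `sepArms (T,F,T,T,F) m (64q) ∩ ⋂_s (extension events in the five frames) ⊆
  ⋃_t fiveArmLandedFrom ({m ≤ |·|} ∩ (Λ_R + c)) (sides of Λ_R + c) m t`.

Everything is proved; no named fact is introduced. The probabilistic half (Nolin's Lemma 13 for
the locally monotone intersection, RSW) is `FiveArmOffCentreExtensionProb.lean`.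

## References

* P. Nolin, Near-critical percolation in two dimensions, *Electron. J. Probab.* 13 (2008)
  1562–1623, §4.2 Def. 6–8, §4.3 Thm. 11, Prop. 12, §5.2 proof of Thm. 24 (arXiv 0711.4948:
  Def. 6–8, Thm. 10, Prop. 11, pp. 16–17) [Nolin2008].
* H. Kesten, V. Sidoravicius, Y. Zhang, Almost all words are seen in critical site percolation on
  the triangular lattice, *Electron. J. Probab.* 3 (1998), proof of Lemma 5, (3.12)–(3.13)
  [KestenSidoraviciusZhang1998].
* H. Kesten, Scaling relations for 2D-percolation, *Comm. Math. Phys.* 109 (1987), Lemma 4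
  (extension of well-separated arms) [Kesten1987].

## Mathlib / tree

Tree: `sepOpenArmIn`, `sepArmAt`, `sepConeSupport`, `glueRegion`, `fourGlueExt`, `fourGluePiece_*`,
`triStrip_subset_glueRegion`, `mem_sepOpenArmIn_inter_support`, `exists_glueSlab`, `PathIn.relay`,
`glueZone`, `glueZone_disjoint`, `disjoint_inter_colour`, `readFrame`, `pathIn_of_rotConfig_colour`
(`ArmSeparationFourArm.lean`, `ArmSeparationGlue.lean`, `ArmEventsAPrioriPoly.lean`), `sepArms`
(`SepArmsGlue.lean`), `fiveArmLandedFrom` (`FiveArmInnerExtensionOff.lean`), `hexSide₀`, `hexSide`,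
`fiveSideIdx`, `triRotIsoPow_apply_sub` (`HexBoundaryGeometry.lean`), `PathIn.last_exit`,
`PathIn.exists_support`, `triNorm_sub_eq_one_of_adj`, `triNorm_le_iff_lin`, `lt_triNorm_iff_lin`,
`triNorm_rot`, `rot_sector_injective`.
-/

noncomputable section

open Set

namespace Literature.Probability.Percolation

open LatticeModels

/-! ### The extension boxes beyond the staircase (frame of side `0`) -/

/-- **The far strip** `[448Q, X] × [-192q, -128q]` (`Q = q + 1`): the rows of the last box of the
staircase of `fourGlueExt q`, continued to the column `x₀ = X`. [cite: Nolin2008, §4.3 Prop. 12 (proof) (arXiv 0711.4948: Prop. 11)] -/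
def extStrip (q : ℕ) (X : ℤ) : Set (Site 2) :=
  triStrip (448 * ((q : ℤ) + 1)) (-(192 * (q : ℤ))) (X - 448 * ((q : ℤ) + 1)).toNat (64 * q)

/-- **The extension event in the frame of side `0`**: the `39` pieces of `fourGlueExt q`, the tube
`[448Q, 512Q-1] × [-192q, -128q]` crossed vertically and the far strip `[448Q, X] × [-192q, -128q]`
crossed horizontally (all open). [cite: Nolin2008, §4.3 Prop. 12 (proof) (arXiv 0711.4948: Prop. 11)] [cite: KestenSidoraviciusZhang1998, proof of Lemma 5, (3.12)] -/
def extEvent (q : ℕ) (X : ℤ) : Set (SiteConfig (Site 2)) :=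
  fourGlueExt q ∩ triVCross (448 * ((q : ℤ) + 1)) (-(192 * (q : ℤ))) (64 * q + 63) (64 * q) ∩
    triHCross (448 * ((q : ℤ) + 1)) (-(192 * (q : ℤ))) (X - 448 * ((q : ℤ) + 1)).toNat (64 * q)

/-- Membership in the far strip, unfolded (`512Q ≤ X`). [folklore] -/
theorem mem_extStrip {q : ℕ} {X : ℤ} (hX : 512 * ((q : ℤ) + 1) ≤ X) {z : Site 2} :
    z ∈ extStrip q X ↔ 448 * ((q : ℤ) + 1) ≤ z 0 ∧ z 0 ≤ X ∧ -(192 * (q : ℤ)) ≤ z 1 ∧ z 1 ≤ -(128 * (q : ℤ)) := by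
  rw [extStrip, mem_triStrip, Int.toNat_of_nonneg (by linarith)]
  constructor
  · rintro ⟨h1, h2, h3, h4⟩; refine ⟨h1, by linarith, h3, by push_cast at h4; linarith⟩
  · rintro ⟨h1, h2, h3, h4⟩; refine ⟨h1, by linarith, h3, by push_cast; linarith⟩

/-- A site of the far strip lies in the open cone, beyond `448Q`; its graph norm is `x₀`. [folklore] -/
theorem cone_of_mem_extStrip {q : ℕ} (hq : 1 ≤ q) {X : ℤ} (hX : 512 * ((q : ℤ) + 1) ≤ X) {z : Site 2}
    (hz : z ∈ extStrip q X) :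
    (0 < z 0 ∧ z 1 < 0 ∧ 0 < z 0 + z 1) ∧ 448 * ((q : ℤ) + 1) ≤ triNorm z ∧ triNorm z = z 0 := by
  obtain ⟨h1, h2, h3, h4⟩ := (mem_extStrip hX).1 hz
  have hq' : (1 : ℤ) ≤ q := by exact_mod_cast hq
  have hn : triNorm z = z 0 := triNorm_eq_apply_zero (by linarith) (by linarith)
  exact ⟨⟨by linarith, by linarith, by linarith⟩, by rw [hn]; exact h1, hn⟩

/-! ### The open path from the inner free space to the far column (frame of side `0`) -/

-- many `linarith` calls on a large context (as in `sepOpenArmIn_glue_core`)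
set_option maxHeartbeats 1600000 in
set_option maxRecDepth 4096 in
/-- **The staircase, continued to the far column** (frame of side `0`). A fenced open arm across
`Λ_{64q} ∖ Λ_m` confined to `X` and the extension event `extEvent q Xf` (`512Q ≤ Xf`) give an open
path, inside `(X ∩ sepConeSupport m (64q)) ∪ glueRegion q ∪ extStrip q Xf`, from a site `u` of the
inner free space of the arm — of graph norm `≤ m - 1` — to a site `f` of the column `x₀ = Xf` in the
rows `[-192q, -128q]`: the staircase of `sepOpenArmIn_glue_core` (its proof, verbatim, up to box
`38`), then box `38` meets the tube, which meets the far box (`PathIn.relay`). [cite: Nolin2008, §4.3 Prop. 12 (proof) (arXiv 0711.4948: Prop. 11)] [cite: KestenSidoraviciusZhang1998, proof of Lemma 5, (3.12)] -/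
theorem sepOpenArmIn_ext_core {q m : ℕ} (hq : 1 ≤ q) (h4 : 4 ≤ m) (h₁ : m ≤ 64 * q) {Xf : ℤ}
    (hXf : 512 * ((q : ℤ) + 1) ≤ Xf) {X : Set (Site 2)} {ω : SiteConfig (Site 2)}
    (hA : ω ∈ sepOpenArmIn X m (64 * q)) (hE : ω ∈ extEvent q Xf) :
    ∃ u f : Site 2, triNorm u ≤ (m : ℤ) - 1 ∧ f 0 = Xf ∧ -(192 * (q : ℤ)) ≤ f 1 ∧ f 1 ≤ -(128 * (q : ℤ)) ∧
      PathIn triGraph ((X ∩ sepConeSupport m (64 * q) ∪ glueRegion q ∪ extStrip q Xf) ∩ ω) u f := by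
  obtain ⟨⟨hG39, hCol⟩, hFar⟩ := hE
  have hG : ∀ k < 39, ω ∈ fourGluePiece q k := by
    intro k hk
    simp only [fourGlueExt, mem_iInter, Finset.mem_range] at hG39
    exact hG39 k hk
  obtain ⟨z, z', u, u', hz, hz', hVin, hVout, hJ⟩ := mem_sepOpenArmIn_inter_support h4 h₁ hA
  set S := sepConeSupport m (64 * q) with hS
  set T : Set (Site 2) := (X ∩ S ∪ glueRegion q ∪ extStrip q Xf) ∩ ω with hT
  -- integer divisions at the exactly divisible scale
  have e4 : 64 * q / 4 = 16 * q := by omega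
  have e8 : 64 * q / 8 = 8 * q := by omega
  have e64 : 64 * q / 64 = q := by omega
  have hq' : (1 : ℤ) ≤ q := by exact_mod_cast hq
  -- the landing row `t = z 1`
  have hzL := hz
  rw [mem_sepLanding, e4] at hzL
  obtain ⟨hz0, hz1, hz2⟩ := hzL
  push_cast at hz0 hz1 hz2
  -- the slab through the outer free space
  obtain ⟨k, hk, hk1, hk2⟩ := exists_glueSlab (s := q) hq (t := z 1) (by linarith) (by linarith)
  -- the crossings
  have hH : ω ∈ triHCross (64 * (q : ℤ) + 1) (((k : ℤ) - 48) * q) (16 * q) q := by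
    rw [← fourGluePiece_lt hk]; exact hG k (by omega)
  have hV : ω ∈ triVCross (72 * (q : ℤ)) (-(49 * (q : ℤ))) (8 * q) (35 * q) := by
    rw [← fourGluePiece_33]; exact hG 33 (by norm_num)
  have hB₀ : ω ∈ triHCross (72 * (q : ℤ)) (-(48 * (q : ℤ))) (64 * q) (16 * q) := by
    rw [← fourGluePiece_34]; exact hG 34 (by norm_num)
  have hV₀ : ω ∈ triVCross (128 * (q : ℤ)) (-(96 * (q : ℤ))) (8 * q) (64 * q) := by
    rw [← fourGluePiece_35]; exact hG 35 (by norm_num)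
  have hB₁ : ω ∈ triHCross (128 * (q : ℤ)) (-(96 * (q : ℤ))) (136 * q) (32 * q) := by
    rw [← fourGluePiece_36]; exact hG 36 (by norm_num)
  have hV₁ : ω ∈ triVCross (256 * (q : ℤ)) (-(192 * (q : ℤ))) (8 * q) (128 * q) := by
    rw [← fourGluePiece_37]; exact hG 37 (by norm_num)
  have hB₂ : ω ∈ triHCross (256 * (q : ℤ)) (-(192 * (q : ℤ))) (256 * q + 511) (64 * q) := by
    rw [← fourGluePiece_38]; exact hG 38 (by norm_num)
  obtain ⟨xH, yH, hxH, hyH, pH⟩ := hH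
  obtain ⟨c, d, hc, hd, pV⟩ := hV
  obtain ⟨x₀, y₀, hx₀, hy₀, pB₀⟩ := hB₀
  obtain ⟨c₀, d₀, hc₀, hd₀, pV₀⟩ := hV₀
  obtain ⟨x₁, y₁, hx₁, hy₁, pB₁⟩ := hB₁
  obtain ⟨c₁, d₁, hc₁, hd₁, pV₁⟩ := hV₁
  obtain ⟨x₂, y₂, hx₂, hy₂, pB₂⟩ := hB₂
  obtain ⟨cC, dC, hcC, hdC, pC⟩ := hCol
  obtain ⟨eF, fF, heF, hfF, pF⟩ := hFar
  push_cast at hyH hd hy₀ hd₀ hy₁ hd₁ hy₂ hdC hfF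
  rw [Int.toNat_of_nonneg (by linarith)] at hfF
  -- the outer fence crossing of the arm
  rw [e64] at hVout
  obtain ⟨b₁, t₁, hb₁, ht₁, pF₁, pF₁'⟩ := hVout
  have pW : PathIn triGraph (sepOuterFence (64 * q) z ∩ (X ∩ S) ∩ ω) b₁ t₁ := pF₁.trans pF₁'
  have hk' : ((k - 48 : ℤ)) * q = (-48 + (k : ℤ)) * q := by ring
  rw [hk'] at pH
  -- junction 1: the thin box `k` and the outer free space of the arm
  have J₁ := PathIn.relay (L := 64 * (q : ℤ) + 1) (R := 72 * (q : ℤ)) (B := z 1 - q) (T := z 1 + q)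
    (by linarith) (by linarith) pH (by rw [hxH]) (by rw [hyH]; linarith)
    (fun w hw _ _ => by rw [mem_triStrip] at hw; push_cast at hw; constructor <;> linarith)
    pW (by rw [hb₁]) (by rw [ht₁])
    (fun w hw _ _ => by rw [mem_inter_iff, mem_sepOuterFence, e8] at hw; push_cast at hw; constructor <;> linarith)
  -- junction 2: the thin box `k` and the tube `33`
  have J₂ := PathIn.relay (L := 72 * (q : ℤ)) (R := 80 * (q : ℤ)) (B := (-48 + (k : ℤ)) * q)
    (T := (-48 + (k : ℤ)) * q + q) (by linarith) (by linarith) pH (by rw [hxH]; linarith) (by rw [hyH]; linarith)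
    (fun w hw _ _ => by rw [mem_triStrip] at hw; push_cast at hw; constructor <;> linarith)
    pV (by rw [hc]; linarith) (by rw [hd]; linarith)
    (fun w hw _ _ => by rw [mem_triStrip] at hw; push_cast at hw; constructor <;> linarith)
  -- junction 3: box `34` and the tube `33`
  have J₃ := PathIn.relay (L := 72 * (q : ℤ)) (R := 80 * (q : ℤ)) (B := -(48 * (q : ℤ))) (T := -(32 * (q : ℤ)))
    (by linarith) (by linarith) pB₀ (by rw [hx₀]) (by rw [hy₀]; linarith)
    (fun w hw _ _ => by rw [mem_triStrip] at hw; push_cast at hw; constructor <;> linarith)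
    pV (by rw [hc]; linarith) (by rw [hd]; linarith)
    (fun w hw _ _ => by rw [mem_triStrip] at hw; push_cast at hw; constructor <;> linarith)
  -- junction 4: box `34` and the tube `35`
  have J₄ := PathIn.relay (L := 128 * (q : ℤ)) (R := 136 * (q : ℤ)) (B := -(48 * (q : ℤ))) (T := -(32 * (q : ℤ)))
    (by linarith) (by linarith) pB₀ (by rw [hx₀]; linarith) (by rw [hy₀]; linarith)
    (fun w hw _ _ => by rw [mem_triStrip] at hw; push_cast at hw; constructor <;> linarith)
    pV₀ (by rw [hc₀]; linarith) (by rw [hd₀]; linarith)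
    (fun w hw _ _ => by rw [mem_triStrip] at hw; push_cast at hw; constructor <;> linarith)
  -- junction 5: box `36` and the tube `35`
  have J₅ := PathIn.relay (L := 128 * (q : ℤ)) (R := 136 * (q : ℤ)) (B := -(96 * (q : ℤ))) (T := -(64 * (q : ℤ)))
    (by linarith) (by linarith) pB₁ (by rw [hx₁]) (by rw [hy₁]; linarith)
    (fun w hw _ _ => by rw [mem_triStrip] at hw; push_cast at hw; constructor <;> linarith)
    pV₀ (by rw [hc₀]) (by rw [hd₀]; linarith)
    (fun w hw _ _ => by rw [mem_triStrip] at hw; push_cast at hw; constructor <;> linarith)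
  -- junction 6: box `36` and the tube `37`
  have J₆ := PathIn.relay (L := 256 * (q : ℤ)) (R := 264 * (q : ℤ)) (B := -(96 * (q : ℤ))) (T := -(64 * (q : ℤ)))
    (by linarith) (by linarith) pB₁ (by rw [hx₁]; linarith) (by rw [hy₁]; linarith)
    (fun w hw _ _ => by rw [mem_triStrip] at hw; push_cast at hw; constructor <;> linarith)
    pV₁ (by rw [hc₁]; linarith) (by rw [hd₁]; linarith)
    (fun w hw _ _ => by rw [mem_triStrip] at hw; push_cast at hw; constructor <;> linarith)
  -- junction 7: box `38` and the tube `37`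
  have J₇ := PathIn.relay (L := 256 * (q : ℤ)) (R := 264 * (q : ℤ)) (B := -(192 * (q : ℤ))) (T := -(128 * (q : ℤ)))
    (by linarith) (by linarith) pB₂ (by rw [hx₂]) (by rw [hy₂]; linarith)
    (fun w hw _ _ => by rw [mem_triStrip] at hw; push_cast at hw; constructor <;> linarith)
    pV₁ (by rw [hc₁]) (by rw [hd₁]; linarith)
    (fun w hw _ _ => by rw [mem_triStrip] at hw; push_cast at hw; constructor <;> linarith)
  -- junction 8: box `38` and the far tube `[448Q, 512Q-1] × [-192q, -128q]`
  have J₈ := PathIn.relay (L := 448 * ((q : ℤ) + 1)) (R := 512 * ((q : ℤ) + 1) - 1)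
    (B := -(192 * (q : ℤ))) (T := -(128 * (q : ℤ)))
    (by linarith) (by linarith) pB₂ (by rw [hx₂]; linarith) (by rw [hy₂]; linarith)
    (fun w hw _ _ => by rw [mem_triStrip] at hw; push_cast at hw; constructor <;> linarith)
    pC (by rw [hcC]) (by rw [hdC]; linarith)
    (fun w hw _ _ => by rw [mem_triStrip] at hw; push_cast at hw; constructor <;> linarith)
  -- junction 9: the far box and the far tube
  have J₉ := PathIn.relay (L := 448 * ((q : ℤ) + 1)) (R := 512 * ((q : ℤ) + 1) - 1)
    (B := -(192 * (q : ℤ))) (T := -(128 * (q : ℤ)))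
    (by linarith) (by linarith) pF (by rw [heF]) (by rw [hfF]; linarith)
    (fun w hw _ _ => by rw [mem_triStrip] at hw; push_cast at hw; constructor <;> linarith)
    pC (by rw [hcC]) (by rw [hdC]; linarith)
    (fun w hw _ _ => by rw [mem_triStrip] at hw; push_cast at hw; constructor <;> linarith)
  -- the regions
  have gH : triStrip (64 * (q : ℤ) + 1) ((-48 + (k : ℤ)) * q) (16 * q) q ⊆ glueRegion q := by
    exact triStrip_subset_glueRegion (by linarith) (by push_cast; linarith) (by linarith) (by linarith)
  have gV : triStrip (72 * (q : ℤ)) (-(49 * (q : ℤ))) (8 * q) (35 * q) ⊆ glueRegion q :=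
    triStrip_subset_glueRegion (by linarith) (by push_cast; linarith) (by push_cast; linarith) (by linarith)
  have gB₀ : triStrip (72 * (q : ℤ)) (-(48 * (q : ℤ))) (64 * q) (16 * q) ⊆ glueRegion q :=
    triStrip_subset_glueRegion (by linarith) (by push_cast; linarith) (by push_cast; linarith) (by linarith)
  have gV₀ : triStrip (128 * (q : ℤ)) (-(96 * (q : ℤ))) (8 * q) (64 * q) ⊆ glueRegion q :=
    triStrip_subset_glueRegion (by linarith) (by push_cast; linarith) (by push_cast; linarith) (by linarith)
  have gB₁ : triStrip (128 * (q : ℤ)) (-(96 * (q : ℤ))) (136 * q) (32 * q) ⊆ glueRegion q :=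
    triStrip_subset_glueRegion (by linarith) (by push_cast; linarith) (by push_cast; linarith) (by linarith)
  have gV₁ : triStrip (256 * (q : ℤ)) (-(192 * (q : ℤ))) (8 * q) (128 * q) ⊆ glueRegion q :=
    triStrip_subset_glueRegion (by linarith) (by push_cast; linarith) (by push_cast; linarith) (by linarith)
  have gB₂ : triStrip (256 * (q : ℤ)) (-(192 * (q : ℤ))) (256 * q + 511) (64 * q) ⊆ glueRegion q :=
    triStrip_subset_glueRegion (by linarith) (by push_cast; linarith) (by push_cast; linarith) (by linarith)
  have gC : triStrip (448 * ((q : ℤ) + 1)) (-(192 * (q : ℤ))) (64 * q + 63) (64 * q) ⊆ extStrip q Xf := by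
    intro w hw; rw [mem_triStrip] at hw; push_cast at hw
    rw [mem_extStrip hXf]; refine ⟨?_, ?_, ?_, ?_⟩ <;> linarith
  have gF : triStrip (448 * ((q : ℤ) + 1)) (-(192 * (q : ℤ))) (Xf - 448 * ((q : ℤ) + 1)).toNat (64 * q) ⊆
      extStrip q Xf := fun w hw => hw
  have mXS : ∀ F : Set (Site 2), F ∩ (X ∩ S) ∩ ω ⊆ T := fun F v hv => ⟨Or.inl (Or.inl hv.1.2), hv.2⟩
  have mG2 : ∀ {F F' : Set (Site 2)}, F ⊆ glueRegion q → F' ⊆ glueRegion q → (F ∪ F') ∩ ω ⊆ T := by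
    intro F F' hF hF' v hv
    rcases hv.1 with h | h
    · exact ⟨Or.inl (Or.inr (hF h)), hv.2⟩
    · exact ⟨Or.inl (Or.inr (hF' h)), hv.2⟩
  have mGE : ∀ {F F' : Set (Site 2)}, F ⊆ glueRegion q → F' ⊆ extStrip q Xf → (F ∪ F') ∩ ω ⊆ T := by
    intro F F' hF hF' v hv
    rcases hv.1 with h | h
    · exact ⟨Or.inl (Or.inr (hF h)), hv.2⟩
    · exact ⟨Or.inr (hF' h), hv.2⟩
  have mEE : ∀ {F F' : Set (Site 2)}, F ⊆ extStrip q Xf → F' ⊆ extStrip q Xf → (F ∪ F') ∩ ω ⊆ T := by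
    intro F F' hF hF' v hv
    rcases hv.1 with h | h
    · exact ⟨Or.inr (hF h), hv.2⟩
    · exact ⟨Or.inr (hF' h), hv.2⟩
  have mE : ∀ {F : Set (Site 2)}, F ⊆ extStrip q Xf → F ∩ ω ⊆ T := fun hF v hv => ⟨Or.inr (hF hv.1), hv.2⟩
  have m₁ : (triStrip (64 * (q : ℤ) + 1) ((-48 + (k : ℤ)) * q) (16 * q) q ∪
      sepOuterFence (64 * q) z ∩ (X ∩ S)) ∩ ω ⊆ T := by
    intro v hv
    rcases hv.1 with h | h
    · exact ⟨Or.inl (Or.inr (gH h)), hv.2⟩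
    · exact ⟨Or.inl (Or.inl h.2), hv.2⟩
  -- the open path from the inner free space of the arm to the far column
  have P : PathIn triGraph T u fF :=
    (hJ.mono (mXS _)) |>.trans (pF₁.symm.mono (mXS _)) |>.trans (J₁.symm.mono m₁)
      |>.trans (J₂.mono (mG2 gH gV)) |>.trans (J₃.symm.mono (mG2 gB₀ gV)) |>.trans (J₄.mono (mG2 gB₀ gV₀))
      |>.trans (J₅.symm.mono (mG2 gB₁ gV₀)) |>.trans (J₆.mono (mG2 gB₁ gV₁)) |>.trans (J₇.symm.mono (mG2 gB₂ gV₁))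
      |>.trans (J₈.mono (mGE gB₂ gC)) |>.trans (J₉.symm.mono (mEE gF gC)) |>.trans (pF.mono (mE gF))
  obtain ⟨b₀, t₀, -, -, pF₀, -⟩ := hVin
  have huF : u ∈ sepInnerFence m z' := pF₀.right_mem.1.1
  have hz'L := hz'
  rw [mem_sepLanding] at hz'L
  rw [mem_sepInnerFence] at huF
  have hu : triNorm u ≤ (m : ℤ) - 1 := by
    rw [triNorm_le_iff_lin]
    have h8 : (m / 8 : ℕ) ≤ m / 4 := Nat.div_le_div_left (by norm_num) (by norm_num)
    have h64 : (m / 64 : ℕ) + m / 8 ≤ m / 4 := by omega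
    have h4' : 1 ≤ m / 4 := by omega
    omega
  have hfrow : -(192 * (q : ℤ)) ≤ fF 1 ∧ fF 1 ≤ -(128 * (q : ℤ)) := by
    have h := pF.right_mem.1
    rw [mem_triStrip] at h; push_cast at h
    constructor <;> linarith
  exact ⟨u, fF, hu, hfF.trans (by ring), hfrow.1, hfrow.2, P⟩

/-! ### Trimming at the inner boundary: the landing site on side `0` of `∂Λ_m` -/

/-- **The landing site.** A site `b` of graph norm `≥ m` adjacent to a site `a` of the open cone
over side `0` of graph norm `≤ m - 1` is the site `(m, b₁)` of side `0` of `∂Λ_m`, off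
its far corner: `b₀ = m`, `-m < b₁ ≤ 0` (and `|b|_𝕋 = m`). [folklore] -/
theorem landingSite_of_adj {m : ℕ} {a b : Site 2}
    (ha : 0 < a 0 ∧ a 1 < 0 ∧ 0 < a 0 + a 1) (han : triNorm a ≤ (m : ℤ) - 1)
    (hab : triGraph.Adj a b) (hbn : (m : ℤ) ≤ triNorm b) :
    b 0 = m ∧ -(m : ℤ) < b 1 ∧ b 1 ≤ 0 := by
  have h1 := triNorm_sub_eq_one_of_adj hab
  have hd : triNorm (a - b) ≤ 1 := h1.le
  rw [triNorm_le_iff_lin] at hd han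
  simp only [Pi.sub_apply] at hd
  have hb' : (m : ℤ) - 1 < triNorm b := by linarith
  rw [lt_triNorm_iff_lin] at hb'
  omega

/-- **A landed open arm in the frame of side `0`.** Under the hypotheses of
`sepOpenArmIn_ext_core` (`m ≥ 4`): there are an inner offset `-m < t ≤ 0` and a set `S` of open
sites of `(X ∩ sepConeSupport m (64q)) ∪ glueRegion q ∪ extStrip q Xf`, all of graph norm `≥ m`,
containing the landing site `(m, t)` of side `0` of `∂Λ_m` and joined inside `S` to a site `f` of
the column `x₀ = Xf` in the rows `[-192q, -128q]` (the path of `sepOpenArmIn_ext_core` after its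
last visit to `Λ_{m-1}`: sites of the support of norm `< m` lie in the open cone, `mem_sepConeSupport`,
so the next site is a landing site, `landingSite_of_adj`). [cite: Nolin2008, §4.2 Def. 7–8 and §4.3 Prop. 12 (arXiv 0711.4948)] [cite: KestenSidoraviciusZhang1998, proof of Lemma 5, (3.12)] -/
theorem sepOpenArmIn_ext_landed {q m : ℕ} (hq : 1 ≤ q) (h4 : 4 ≤ m) (h₁ : m ≤ 64 * q) {Xf : ℤ}
    (hXf : 512 * ((q : ℤ) + 1) ≤ Xf) {X : Set (Site 2)} {ω : SiteConfig (Site 2)}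
    (hA : ω ∈ sepOpenArmIn X m (64 * q)) (hE : ω ∈ extEvent q Xf) :
    ∃ t : ℤ, (-(m : ℤ) < t ∧ t ≤ 0) ∧ ∃ (S : Set (Site 2)) (f : Site 2),
      S ⊆ (X ∩ sepConeSupport m (64 * q) ∪ glueRegion q ∪ extStrip q Xf) ∩ ω ∧
      (∀ x ∈ S, (m : ℤ) ≤ triNorm x) ∧ ![(m : ℤ), t] ∈ S ∧ f ∈ S ∧
      (f 0 = Xf ∧ -(192 * (q : ℤ)) ≤ f 1 ∧ f 1 ≤ -(128 * (q : ℤ))) ∧ ∀ x ∈ S, PathIn triGraph S x f := by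
  obtain ⟨u, f, hu, hf0, hf1, hf2, P⟩ := sepOpenArmIn_ext_core hq h4 h₁ hXf hA hE
  set W : Set (Site 2) := (X ∩ sepConeSupport m (64 * q) ∪ glueRegion q ∪ extStrip q Xf) ∩ ω with hW
  set C : Set (Site 2) := {z | triNorm z ≤ (m : ℤ) - 1} with hC
  have e8 : 64 * q / 8 = 8 * q := by omega
  -- sites of `W` of norm `≤ m - 1` lie in the open cone
  have hcone : ∀ z ∈ W, triNorm z ≤ (m : ℤ) - 1 → (0 < z 0 ∧ z 1 < 0 ∧ 0 < z 0 + z 1) := by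
    rintro z ⟨((hz | hz) | hz), -⟩ hzn
    · have h := hz.2
      rw [mem_sepConeSupport] at h
      exact h.2.2 (Or.inl (by linarith))
    · have h := (mem_triCone_of_mem_glueRegion hz).2.1
      have hq' : (1 : ℤ) ≤ q := by exact_mod_cast hq
      have : (m : ℤ) ≤ 64 * q := by exact_mod_cast h₁
      linarith
    · have h := (cone_of_mem_extStrip hq hXf hz).2.1
      have : (m : ℤ) ≤ 64 * q := by exact_mod_cast h₁
      linarith
  have hfC : f ∉ C := by
    intro hfC'
    rw [hC, mem_setOf_eq] at hfC'
    have h := (abs_le_triNorm f).1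
    rw [hf0] at h
    have h' := (abs_le.1 h).2
    have : (m : ℤ) ≤ 64 * q := by exact_mod_cast h₁
    linarith
  obtain ⟨a, b, haC, haW, hbC, hab, Q⟩ := P.last_exit (C := C) (by exact hu) hfC
  have hbn : (m : ℤ) ≤ triNorm b := by
    rw [hC, mem_setOf_eq, not_le] at hbC; linarith
  obtain ⟨hb0, hb1, hb2⟩ := landingSite_of_adj (hcone a haW haC) haC hab hbn
  have hbeq : b = ![(m : ℤ), b 1] := by
    ext i; fin_cases i
    · simpa using hb0
    · simp
  -- the support of the trimmed path, every site joined to `f`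
  obtain ⟨S, hSW, hSf, hSall⟩ := Q.symm.exists_support
  refine ⟨b 1, ⟨hb1, hb2⟩, S, f, fun x hx => (hSW hx).1, fun x hx => ?_, hbeq ▸ hSf.right_mem,
    hSf.left_mem, ⟨hf0, hf1, hf2⟩, fun x hx => (hSall x hx).symm⟩
  have h := (hSW hx).2
  rw [hC, mem_setOf_eq, not_le] at h
  linarith

/-! ### The five extended arms in the original frame -/

/-- **The zone of the extended arm of side `s`** in the original frame: the carrier
`X ∩ ρ^s(sepConeSupport m (64q))`, the rotated gluing region `ρ^s(glueRegion q)` and the rotated far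
strip `ρ^s(extStrip q Xf)`. [cite: Nolin2008, §4.3 Prop. 12 (proof) (arXiv 0711.4948: Prop. 11)] -/
def extZone (q m s : ℕ) (X : Set (Site 2)) (Xf : ℤ) : Set (Site 2) :=
  X ∩ triRotIsoPow s '' sepConeSupport m (64 * q) ∪ triRotIsoPow s '' glueRegion q ∪
    triRotIsoPow s '' extStrip q Xf

/-- The zone is the `ρ^s`-image of the carrier of the frame-`0` lemmas. [folklore] -/
theorem image_rot_extCarrier (q m s : ℕ) (X : Set (Site 2)) (Xf : ℤ) :
    triRotIsoPow s '' ((triRotIsoPow s) ⁻¹' X ∩ sepConeSupport m (64 * q) ∪ glueRegion q ∪ extStrip q Xf) =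
      extZone q m s X Xf := by
  rw [image_union, image_union, image_preimage_inter]
  rfl

/-- The far strip lies in the cone support of the scale `(512Q, n₃)` for `Xf ≤ n₃`. [folklore] -/
theorem extStrip_subset_sepConeSupport {q : ℕ} (hq : 1 ≤ q) {Xf : ℤ} {n₃ : ℕ}
    (hX : 512 * ((q : ℤ) + 1) ≤ Xf) (hn₃ : Xf ≤ n₃) :
    extStrip q Xf ⊆ sepConeSupport (512 * (q + 1)) n₃ := by
  intro u hu
  obtain ⟨hc, h448, hn⟩ := cone_of_mem_extStrip hq hX hu
  obtain ⟨h1, h2, h3, h4⟩ := (mem_extStrip hX).1 hu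
  have E8 : 512 * (q + 1) / 8 = 64 * (q + 1) := by omega
  rw [mem_sepConeSupport, E8]
  have h0 : (0 : ℤ) ≤ ((n₃ / 8 : ℕ) : ℤ) := Int.natCast_nonneg _
  refine ⟨?_, by linarith, fun _ => hc⟩
  push_cast
  linarith

/-- The zone of an extended arm lies in the zone `glueZone` of `ArmSeparationFourArm.lean` with outer
carrier the rotated far strip (`Xf ≤ n₃`). [folklore] -/
theorem extZone_subset_glueZone {q m s : ℕ} (hq : 1 ≤ q) {X : Set (Site 2)} {Xf : ℤ} {n₃ : ℕ}
    (hX : 512 * ((q : ℤ) + 1) ≤ Xf) (hn₃ : Xf ≤ n₃) :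
    extZone q m s X Xf ⊆ glueZone q m n₃ s X (triRotIsoPow s '' extStrip q Xf) := by
  rintro w ((hw | hw) | hw)
  · exact Or.inl (Or.inl hw)
  · exact Or.inl (Or.inr hw)
  · obtain ⟨u, hu, rfl⟩ := hw
    exact Or.inr ⟨⟨u, hu, rfl⟩, u, extStrip_subset_sepConeSupport hq hX hn₃ hu, rfl⟩

/-- Rotated far strips of different frames are disjoint (they lie in different open cones). [folklore] -/
theorem disjoint_image_rot_extStrip {q : ℕ} (hq : 1 ≤ q) {a b : ℕ} (ha : a < 6) (hb : b < 6) (hab : a ≠ b)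
    {Xa Xb : ℤ} (hXa : 512 * ((q : ℤ) + 1) ≤ Xa) (hXb : 512 * ((q : ℤ) + 1) ≤ Xb) :
    Disjoint (triRotIsoPow a '' extStrip q Xa) (triRotIsoPow b '' extStrip q Xb) := by
  rw [Set.disjoint_left]
  rintro w ⟨u, hu, rfl⟩ ⟨u', hu', hu'w⟩
  exact hab (rot_sector_injective ha hb (cone_of_mem_extStrip hq hXa hu).1 (cone_of_mem_extStrip hq hXb hu').1
    hu'w.symm)

/-- **The zones of the five extended arms, intersected with their colour classes, are pairwise
disjoint** (`glueZone_colour_disjoint` with outer carriers the rotated far strips). [cite: Nolin2008, §4.3 Prop. 12 (proof) (arXiv 0711.4948: Prop. 11)] -/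
theorem extZone_colour_disjoint {q m : ℕ} (hq : 1 ≤ q) {X : Fin 5 → Set (Site 2)}
    (hX : ∀ i j, i ≠ j → nolinFive i = nolinFive j → Disjoint (X i) (X j)) {Xf : Fin 5 → ℤ}
    (hXf : ∀ j, 512 * ((q : ℤ) + 1) ≤ Xf j) (ω : SiteConfig (Site 2)) {i j : Fin 5} (hij : i ≠ j) :
    Disjoint (extZone q m i.val (X i) (Xf i) ∩ {v | v ∈ ω ↔ nolinFive i})
      (extZone q m j.val (X j) (Xf j) ∩ {v | v ∈ ω ↔ nolinFive j}) := by
  set n₃ : ℕ := max (Xf i).toNat (Xf j).toNat with hn₃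
  have hi3 : Xf i ≤ n₃ := (Int.self_le_toNat _).trans (by rw [hn₃]; exact_mod_cast le_max_left _ _)
  have hj3 : Xf j ≤ n₃ := (Int.self_le_toNat _).trans (by rw [hn₃]; exact_mod_cast le_max_right _ _)
  have hY : ∀ a b : Fin 5, a ≠ b → nolinFive a = nolinFive b →
      Disjoint ((fun c : Fin 5 => triRotIsoPow c.val '' extStrip q (Xf c)) a)
        ((fun c : Fin 5 => triRotIsoPow c.val '' extStrip q (Xf c)) b) :=
    fun a b hab _ => disjoint_image_rot_extStrip hq (by have := a.2; omega) (by have := b.2; omega)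
      (fun h => hab (Fin.ext h)) (hXf a) (hXf b)
  have h := glueZone_colour_disjoint (k := 5) (by norm_num) nolinFive (q := q) (n₁ := m) (n₃ := n₃) hq hX hY ω hij
  exact h.mono (inter_subset_inter_left _ (extZone_subset_glueZone hq (hXf i) hi3))
    (inter_subset_inter_left _ (extZone_subset_glueZone hq (hXf j) hj3))

/-- **A landed arm of colour `b` on side `s`, in the original frame.** From a fenced arm of colour
`b` landing on side `s` confined to `X` (`sepArmAt s b X m (64q)`) and the extension event read in
colour `b` in frame `s`: an inner offset `-m < t ≤ 0` and a set `S` of sites of colour `b` of the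
zone `extZone q m s X Xf`, all of norm `≥ m`, containing `ρ^s(m, t)` and `ρ^s f` with `f₀ = Xf`,
`-192q ≤ f₁ ≤ -128q`, every site of `S` joined to `ρ^s f` inside `S` (`sepOpenArmIn_ext_landed`
carried by `ρ^s`). [cite: Nolin2008, §4.2 Def. 7–8 and §4.3 Prop. 12 (arXiv 0711.4948)] -/
theorem sepArmAt_ext_landed {q m s : ℕ} {b : Bool} (hq : 1 ≤ q) (h4 : 4 ≤ m) (h₁ : m ≤ 64 * q) {Xf : ℤ}
    (hXf : 512 * ((q : ℤ) + 1) ≤ Xf) {X : Set (Site 2)} {ω : SiteConfig (Site 2)}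
    (hA : ω ∈ sepArmAt s b X m (64 * q)) (hE : readFrame s b ω ∈ extEvent q Xf) :
    ∃ t : ℤ, (-(m : ℤ) < t ∧ t ≤ 0) ∧ ∃ (S : Set (Site 2)) (f : Site 2),
      S ⊆ extZone q m s X Xf ∩ {z | z ∈ ω ↔ b} ∧ (∀ x ∈ S, (m : ℤ) ≤ triNorm x) ∧
      triRotIsoPow s ![(m : ℤ), t] ∈ S ∧ triRotIsoPow s f ∈ S ∧
      (f 0 = Xf ∧ -(192 * (q : ℤ)) ≤ f 1 ∧ f 1 ≤ -(128 * (q : ℤ))) ∧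
      ∀ x ∈ S, PathIn triGraph S x (triRotIsoPow s f) := by
  rw [mem_sepArmAt] at hA
  obtain ⟨t, ht, S, f, hSW, hSm, htS, hfS, hf, hconn⟩ := sepOpenArmIn_ext_landed hq h4 h₁ hXf hA hE
  refine ⟨t, ht, triRotIsoPow s '' S, f, ?_, ?_, mem_image_of_mem _ htS, mem_image_of_mem _ hfS, hf, ?_⟩
  · rintro _ ⟨x, hx, rfl⟩
    obtain ⟨hxW, hxω⟩ := hSW hx
    refine ⟨?_, ?_⟩
    · rw [← image_rot_extCarrier]; exact mem_image_of_mem _ hxW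
    · exact mem_readFrame.1 hxω
  · rintro _ ⟨x, hx, rfl⟩
    rw [triNorm_rot]; exact hSm x hx
  · rintro _ ⟨x, hx, rfl⟩
    exact pathIn_map_iso (triRotIsoPow s) (hconn x hx)

/-- **The extended arm stays in the off-centre hexagon.** If `|v'|_𝕋 ≤ 128q` and
`R ≥ 512Q + 128q`, every site `w` of the zone of side `s` with far column `Xf = R - v'₀` satisfies
`|w + ρ^s v'|_𝕋 ≤ R`, i.e. lies in the hexagon `Λ_R - ρ^s v'`. [folklore] -/
theorem triNorm_add_rot_le_of_mem_extZone {q m s R : ℕ} {X : Set (Site 2)} {v' w : Site 2}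
    (hv : triNorm v' ≤ 128 * q) (hR : 512 * (q + 1) + 128 * q ≤ R)
    (hw : w ∈ extZone q m s X ((R : ℤ) - v' 0)) : triNorm (w + triRotIsoPow s v') ≤ R := by
  have h2 := triNorm_le_iff_lin.1 hv
  have hR' : (512 : ℤ) * ((q : ℤ) + 1) + 128 * (q : ℤ) ≤ (R : ℤ) := by exact_mod_cast hR
  have e8 : 64 * q / 8 = 8 * q := by omega
  rcases hw with ((⟨-, u, hu, rfl⟩ | ⟨u, hu, rfl⟩) | ⟨u, hu, rfl⟩)
  · rw [← triRotIsoPow_apply_add, triNorm_rot]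
    rw [mem_sepConeSupport, e8] at hu
    push_cast at hu
    have h1 := triNorm_le_iff_lin.1 hu.2.1
    rw [triNorm_le_iff_lin]; simp only [Pi.add_apply]; omega
  · rw [← triRotIsoPow_apply_add, triNorm_rot]
    obtain ⟨-, -, hlt⟩ := mem_triCone_of_mem_glueRegion hu
    have h1 := triNorm_lt_iff_lin.1 hlt
    rw [triNorm_le_iff_lin]; simp only [Pi.add_apply]; omega
  · rw [← triRotIsoPow_apply_add, triNorm_rot]
    have hX : 512 * ((q : ℤ) + 1) ≤ (R : ℤ) - v' 0 := by omega
    obtain ⟨a1, a2, a3, a4⟩ := (mem_extStrip hX).1 hu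
    rw [triNorm_le_iff_lin]; simp only [Pi.add_apply]; omega

/-- **The far end lands on side `s` of the off-centre hexagon**: `ρ^s f + ρ^s v' ∈ hexSide R s`
for `f₀ = R - v'₀`, `-192q ≤ f₁ ≤ -128q`, `|v'|_𝕋 ≤ 128q`, `R ≥ 512Q + 128q`. [folklore] -/
theorem rot_add_mem_hexSide {q s R : ℕ} {v' f : Site 2} (hv : triNorm v' ≤ 128 * q)
    (hR : 512 * (q + 1) + 128 * q ≤ R)
    (hf : f 0 = (R : ℤ) - v' 0 ∧ -(192 * (q : ℤ)) ≤ f 1 ∧ f 1 ≤ -(128 * (q : ℤ))) :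
    triRotIsoPow s f + triRotIsoPow s v' ∈ hexSide R s := by
  rw [← triRotIsoPow_apply_add, mem_hexSide_iff]
  have h2 := triNorm_le_iff_lin.1 hv
  have hR' : (512 : ℤ) * ((q : ℤ) + 1) + 128 * (q : ℤ) ≤ (R : ℤ) := by exact_mod_cast hR
  obtain ⟨hf0, hf1, hf2⟩ := hf
  refine ⟨f + v', ⟨?_, ?_, ?_⟩, rfl⟩ <;> simp only [Pi.add_apply] <;> omega

/-- The sides of the arms of `fiveArmLandedFrom` as a permutation of `Fin 5`: `0, 4, 2, 3, 1`
(`fiveSideIdx` with values in `Fin 5`). [folklore] -/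
def fiveSideFin : Fin 5 → Fin 5 := ![0, 4, 2, 3, 1]

/-- `fiveSideFin` has the values of `fiveSideIdx`. [folklore] -/
theorem fiveSideFin_val (i : Fin 5) : (fiveSideFin i).val = fiveSideIdx i := by
  fin_cases i <;> rfl

/-- The colour of arm `i` of `fiveArmLandedFrom` is the colour `nolinFive (fiveSideFin i)` carried by
its side in `sepArms nolinFive` (`B, W, B, B, W` on the sides `0, 4, 2, 3, 1`). [folklore] -/
theorem nolinFive_fiveSideFin (i : Fin 5) : nolinFive (fiveSideFin i) = nolinFive i := by
  fin_cases i <;> rfl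

/-- `fiveSideFin` is injective. [folklore] -/
theorem fiveSideFin_injective : Function.Injective fiveSideFin := by
  unfold fiveSideFin; decide

/-- **Five well-separated arms, extended in their frames, land on the sides of the off-centre
hexagon** (the deterministic half of Nolin's "`P(A_v) ≍ P(0 ⇝^{5,σ} ∂S_N)` uniformly in
`v ∈ S_{N/2}`", proof of Thm. 24, via Thm. 11 and Prop. 12; KSZ 1998, (3.12), after Kesten 1987,
Lemma 4). Let `q ≥ 1`, `4 ≤ m ≤ 64q`, `|v|_𝕋 ≤ 128q`, `R ≥ 512(q+1) + 128q`. If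
`ω ∈ sepArms (B,W,B,B,W) m (64q)` (arm `j` fenced, of colour `σ_j`, landing on the middle halves of
side `j`) and, for every `j < 5`, the configuration read in colour `σ_j` in frame `j` lies in the
extension event `extEvent q (R - ((ρ^j)⁻¹ v)₀)`, then for some admissible inner offsets `t`
(`innerOffsets m`) the configuration has five pairwise disjoint landed arms
`fiveArmLandedFrom A I m t` with `A = {m ≤ |z|_𝕋, |z + v|_𝕋 ≤ R}` (the hexagon `Λ_R - v` off
`Λ̊_m`) and landing areas `I_i = (side s_i of ∂Λ_R) - v`, `s = (0, 4, 2, 3, 1)`, colours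
`B, W, B, B, W`. [cite: Nolin2008, §5.2 proof of Thm. 24 with §4.3 Thm. 11, Prop. 12 (arXiv 0711.4948: Thm. 23 (iii), Thm. 10, Prop. 11)] [cite: KestenSidoraviciusZhang1998, proof of Lemma 5, (3.12)] -/
theorem sepArms_ext_subset_landedFrom {q m R : ℕ} {v : Site 2} (hq : 1 ≤ q) (h4 : 4 ≤ m)
    (h₁ : m ≤ 64 * q) (hv : triNorm v ≤ 128 * q) (hR : 512 * (q + 1) + 128 * q ≤ R)
    {ω : SiteConfig (Site 2)} (hA : ω ∈ sepArms nolinFive m (64 * q))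
    (hE : ∀ j : Fin 5, readFrame j.val (nolinFive j) ω ∈
      extEvent q ((R : ℤ) - ((triRotIsoPow j.val).symm v) 0)) :
    ω ∈ ⋃ t ∈ innerOffsets m,
      fiveArmLandedFrom {z | (m : ℤ) ≤ triNorm z ∧ triNorm (z + v) ≤ R}
        (fun i => {z | z + v ∈ hexSide R (fiveSideIdx i)}) m t := by
  obtain ⟨X, hX, hAj⟩ := hA
  have hv' : ∀ s : ℕ, triNorm ((triRotIsoPow s).symm v) ≤ 128 * q := fun s => by
    rw [← triNorm_rot s ((triRotIsoPow s).symm v), RelIso.apply_symm_apply]; exact hv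
  have hR' : (512 : ℤ) * ((q : ℤ) + 1) + 128 * (q : ℤ) ≤ (R : ℤ) := by exact_mod_cast hR
  have hXf : ∀ s : ℕ, 512 * ((q : ℤ) + 1) ≤ (R : ℤ) - ((triRotIsoPow s).symm v) 0 := fun s => by
    have h := (triNorm_le_iff_lin.1 (hv' s)).1
    omega
  -- the five arms, one frame at a time
  have frame : ∀ j : Fin 5, ∃ (t : ℤ) (S : Set (Site 2)) (b : Site 2), (-(m : ℤ) < t ∧ t ≤ 0) ∧
      S ⊆ extZone q m j.val (X j) ((R : ℤ) - ((triRotIsoPow j.val).symm v) 0) ∩ {z | z ∈ ω ↔ nolinFive j} ∧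
      (∀ x ∈ S, (m : ℤ) ≤ triNorm x) ∧ triRotIsoPow j.val ![(m : ℤ), t] ∈ S ∧
      b + v ∈ hexSide R j.val ∧ ∀ x ∈ S, PathIn triGraph S x b := by
    intro j
    obtain ⟨t, ht, S, f, hSZ, hSm, htS, -, hf, hconn⟩ :=
      sepArmAt_ext_landed hq h4 h₁ (hXf j.val) (hAj j) (hE j)
    refine ⟨t, S, triRotIsoPow j.val f, ht, hSZ, hSm, htS, ?_, hconn⟩
    have h := rot_add_mem_hexSide (s := j.val) (hv' j.val) hR hf
    rwa [RelIso.apply_symm_apply] at h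
  choose t S b ht hSZ hSm htS hbI hconn using frame
  refine mem_iUnion₂.2 ⟨fun i => t (fiveSideFin i), mem_innerOffsets.2 fun i => ht _, ?_⟩
  refine ⟨fun i => S (fiveSideFin i), fun i => ⟨?_, ?_, ?_, ?_⟩, ?_⟩
  · intro x hx
    refine ⟨hSm _ x hx, ?_⟩
    have h := triNorm_add_rot_le_of_mem_extZone (s := (fiveSideFin i).val) (hv' _) hR (hSZ _ hx).1
    rwa [RelIso.apply_symm_apply] at h
  · intro x hx
    have h := (hSZ (fiveSideFin i) hx).2
    rw [mem_setOf_eq, nolinFive_fiveSideFin] at h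
    exact h
  · have h := htS (fiveSideFin i)
    rw [fiveSideFin_val] at h
    exact h
  · have h := hbI (fiveSideFin i)
    rw [fiveSideFin_val] at h
    exact ⟨b _, h, hconn _⟩
  · intro i j hij
    have hij' : fiveSideFin i ≠ fiveSideFin j := fun h => hij (fiveSideFin_injective h)
    exact (extZone_colour_disjoint (Xf := fun c : Fin 5 => (R : ℤ) - ((triRotIsoPow c.val).symm v) 0)
      hq hX (fun c => hXf c.val) ω hij').mono (hSZ _) (hSZ _)

end Literature.Probability.Percolation

end
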